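import Summits.BirchSwinnertonDyer.BirchSwinnertonDyer.Theorems.EisensteinPrimesKatzLineDescent
import Summits.BirchSwinnertonDyer.BirchSwinnertonDyer.Theorems.EisensteinPrimesKatzLineIntFrameOfResidualPair
import Summits.BirchSwinnertonDyer.BirchSwinnertonDyer.Theorems.EisensteinPrimesKatzLineExistsOfTeichmuller
import HarnessLib

/-!
# AN-F₂ `KatzLineDescentAt` from CGLS Thm. 2.1.2 BY NAME: the assembly
# `stub_katzLineDescent(Q) ⇐ h212 ∘ (♭ → R₀ index transfer) ∘ (Teichmüller / residual-pair plumbing)`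
# (helper file for crux 2 `GoodLatticeBDPValue`, stmt-BirchSwinnertonDyer-19032, line `halves`, stub 3
# `stub_anDS` and its v19 re-cut; piece AN-F₂ of `Cruxes/GoodLatticeBDPValue/Lines/halves_anDS_split_idea11g4.lean`;
# seat `bsd-line-x1-p1-w3` gen 2 — host split l.3057: w4 gen 2 owns the rigidity statement, w3 gen 2 the assembly)

AN-F₂ (idea-11 g5 rev 2, `KatzLineDescentAt W p`): on the data of the line up to the Hecke character
`θ_K` of the quotient character of the good lattice, for every `m`, IF some `𝓞_{ℂ_p}`-valued CGLS-type
frame `(Ω_K', Ω_p', Q)` of `θ_K` (`Cbar = ∅`, `‖Ω_p'‖ = 1`) has its first unit coefficient at `m`, THEN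
some `R₀`-valued CGLS frame `(Ω_K'', Ω_p'' ∈ R₀ˣ, L_φ)` has `IsKatzLFunction … L_φ ∧ FirstUnitCoeffAt L_φ m`.
Width seat w4 gen 2 proved the TRANSFER (`KatzLineRigidity.exists_isKatzLFunction_firstUnitCoeffAt_of_katzFlat`,
file `…KatzLineDescent`: the index passes from one ♭-frame to EVERY `R₀`-frame, given that an
`R₀`-frame exists and `θ_K` has finite order). This file feeds it the EXISTENCE from the published fact
`CastellaGrossiLeeSkinner2022.thm212_exists_isKatzLFunction` (CGLS Thm. 2.1.2, PUB, hypothesis `h212`)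
instantiated at the plumbed binders — an instantiation that is width seat w2 gen 2's
`KatzLineFrame.exists_isKatzLFunction_of_teichmullerPair` (`θ := 𝟙̃`, `C := N_E`; Teichmüller torsion,
Néron–Ogg–Shafarevich off `N_E`, [LOCp] at `p`) — and assembles AN-F₂ in both currencies:

* §1 `katzLineDescentQ_of_thm212` — AN-F₂ in the `ℚ`-CURRENCY (binders of w2's
  `KatzLineFrame.katzLineIntFrame_of_teichmullerPair` through `hθK` verbatim, then `∀ m`, the ♭-frame
  hypothesis and the `R₀`-frame conclusion of `KatzLineDescentAt` with `IsKatzLFunctionInt` /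
  `IntFirstUnitCoeffAt` unfolded): `h212` (w2's existence) ∘ `θ_K` finite order
  (`KatzLineFrame.heckeCharOf_quotChar_finiteOrder_galConj_unramified`) ∘ w4's transfer.
* §2 `katzLineDescent_of_thm212` — AN-F₂ in the `K`-CURRENCY, i.e. the idea file's
  `KatzLineDescentAt W p` token for token behind `h212 →`: every residual pair over `K` is the
  restricted Teichmüller pair (`ResidualLineRigidity.residualPair_eq_restrictField`, w2 gen 2), then §1.
* §3 `stub_katzLineDescentQ` — the REGISTERED stub 3c of skeleton `halves` v19 (LEAD g3), header verbatim,
  closed by §1.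

THEOREMS ONLY (no definition, no named fact introduced, no `sorry`); the PUBLISHED input enters as the
hypothesis `h212`; Hida's `μ = 0` is not used (w4's transfer moves the unit coefficient). Nothing about
BSD / IMC2 / the crux is proved here; with w2's AN-F₁ (`katzLineIntFrame_of_teichmullerPair`, II.6.4 as
hypothesis) and this file, the LINE FRAME (d1) of the AN split is kernel modulo two published facts.
References: [CastellaGrossiLeeSkinner2022] Thm. 2.1.2 (arXiv:2008.02571v2 TeX L1015–1041);
[KellerYin2024] §1.4, Thms. 2.2.1–2.2.2; [Washington1997] §7.1–7.2.
-/

-- the summit namespace `Summit.BirchSwinnertonDyer.BirchSwinnertonDyer` repeats the problem name by design (D-0017)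
set_option linter.dupNamespace false
set_option autoImplicit false

noncomputable section

open scoped Classical Topology

open Filter WeierstrassCurve NumberField IsDedekindDomain Field PowerSeries
  Literature.NumberTheory.EllipticCurves Literature.NumberTheory.EllipticCurves.Rank1Residual
  Literature.NumberTheory.GaloisRepresentations Literature.NumberTheory.GaloisRepresentations.HeckeCharacter
  Literature.NumberTheory.QuadraticFields
  Literature.NumberTheory.EllipticCurves.CastellaGrossiLeeSkinner2022
  Literature.NumberTheory.EllipticCurves.KellerYin2024
  Summit.BirchSwinnertonDyer.Rank1Residual.X11b
  Summit.BirchSwinnertonDyer.BirchSwinnertonDyer.Theorems.EisensteinPrimesMuLambda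
  Summit.BirchSwinnertonDyer.BirchSwinnertonDyer.Theorems.KatzLineFrame
  Summit.BirchSwinnertonDyer.BirchSwinnertonDyer.Theorems.KatzLineRigidity
  Summit.BirchSwinnertonDyer.BirchSwinnertonDyer.Theorems.ResidualLineRigidity
  Summit.BirchSwinnertonDyer.Rank1Residual.X1.KellerYinMuLambdaSplit

namespace Summit.BirchSwinnertonDyer.BirchSwinnertonDyer.Theorems.KatzLineDescent

/-! ## §1 AN-F₂ in the `ℚ`-currency -/

/-- **AN-F₂ `KatzLineDescentAt`, `ℚ`-CURRENCY, from CGLS Thm. 2.1.2 by name.** On the data — `2 < p`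
good, reducible, anomalous, no unramified rational `p`-line; `K` imaginary quadratic with (Heeg) for
`N_E` and `p`, `D_K` odd, `≠ −3`; `v` read through `ι` and through `ι'`, `v̄` the other prime; `κ`
anticyclotomic with top generator `γ`; a rational `p`-line `Φ` with Teichmüller pair `(θsub, θquot)`;
`θ_K` the Hecke character of `θquot|_{Γ_K}` — FOR EVERY `m`: if SOME `𝓞_{ℂ_p}`-valued CGLS-type frame
`(Ω_K', Ω_p', Q)` of `θ_K` at `γ` (`Cbar = ∅`, `‖Ω_p'‖ = 1`) has its first unit coefficient at `m`, then
SOME `R₀`-frame `(Ω_K'', Ω_p'' ∈ R₀ˣ, L_φ)` has `IsKatzLFunction ι' v v̄ ∅ κ γ θ_K Ω_K'' Ω_p'' L_φ` and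
`FirstUnitCoeffAt L_φ m`. Proof: an `R₀`-frame exists (§1, `h212`); `θ_K` has finite order
(`heckeCharOf_quotChar_finiteOrder_galConj_unramified`); the first-unit index passes from the ♭-frame
to every `R₀`-frame (w4 gen 2, `KatzLineRigidity.exists_isKatzLFunction_firstUnitCoeffAt_of_katzFlat`:
power-map functional equation + `λ`-rigidity over `𝓞_{ℂ_p}⟦T⟧`).
[cite: CastellaGrossiLeeSkinner2022, Thm. 2.1.2 (arXiv:2008.02571v2 TeX L1015–1041)]
[cite: KellerYin2024, Thms. 2.2.1–2.2.2 (arXiv:2402.12781v2 TeX L1426–1448)] [cite: Washington1997, §7.1 Prop. 7.2, §7.2] -/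
theorem katzLineDescentQ_of_thm212 (h212 : thm212_exists_isKatzLFunction)
    (W : WeierstrassCurve ℚ) [W.IsElliptic] [W.IsGloballyMinimal] (p : ℕ) [Fact p.Prime] :
    2 < p → Good W p → Red W p → Anom W p →
    (∀ Φ : AddSubgroup (geomTorsion W (p : ℤ)), IsRationalLine W p Φ → ¬ LineUnramifiedAt W p Φ) →
    ∀ (K : Type) [Field K] [NumberField K], IsImaginaryQuadratic K →
      SatisfiesHeegnerHypothesis (W.conductorNorm ℤ) K → SatisfiesHeegnerHypothesis p K →
      Odd (NumberField.discr K) → NumberField.discr K ≠ -3 →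
    ∀ (ι : K →+* ℚ_[p]) (v vbar : HeightOneSpectrum (𝓞 K)),
      (∀ x : 𝓞 K, x ∈ v.asIdeal ↔ ‖ι (x : K)‖ < 1) →
      ((p : ℕ) : 𝓞 K) ∈ vbar.asIdeal → vbar ≠ v →
    ∀ (κ : ZpExtension K p), κ.IsAnticyclotomic →
    ∀ (γ : absoluteGaloisGroup K) [Fact (κ.IsTopGenerator γ)],
    ∀ (ι' : PadicAlgCl p ≃+* ℂ),
      (∀ (w : InfinitePlace K) (k : 𝓞 K), k ∈ v.asIdeal ↔ ‖ι'.symm (w.embedding (k : K))‖ < 1) →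
    ∀ (Φ : AddSubgroup (geomTorsion W (p : ℤ))), IsRationalLine W p Φ →
    ∀ (θsub θquot : FramedGaloisRep ℚ (padicCoeffIntegers (∅ : Set (PadicAlgCl p))) 1),
      IsTeichmullerLiftOn (∅ : Set (PadicAlgCl p)) (Φ.map (geomTorsion W (p : ℤ)).subtype) θsub →
      IsTeichmullerLiftOnQuot (∅ : Set (PadicAlgCl p)) (Φ.map (geomTorsion W (p : ℤ)).subtype)
        (geomTorsion W (p : ℤ)) θquot →
    ∀ (θK : HeckeCharacter K), IsHeckeCharOf ι' (θquot.restrictField K) θK →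
    ∀ m : ℕ,
      (∃ (ΩK' : ℂ) (Ωp' : ℂ_[p]) (Q : PowerSeries 𝓞_ℂ_[p]), ΩK' ≠ 0 ∧ ‖Ωp'‖ = 1 ∧
        (∀ (φ : HeckeCharacter K) (n : ℕ), 0 < n → (p - 1) ∣ n →
          (∀ w : HeightOneSpectrum (𝓞 K), φ.IsUnramifiedAt w) →
          φ.HasInfinityType (fun _ ↦ (n : ℤ)) (fun _ ↦ -(n : ℤ)) →
          ∀ (hL : LFunction.HasEntireContinuation (heckeLFunction (θK * φ))),
          ∀ r : FramedGaloisRep K (PadicAlgCl p) 1, IsPAdicAvatarOf ι' φ r → FactorsThroughZp κ r →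
            IntSeries.HasValueAt Q (avatarValueAt r γ - 1)
              (((ι'.symm (katzInterpolationValue p θK v vbar ∅ φ n ΩK' (hL.continuation 1)) :
                  PadicAlgCl p) : ℂ_[p]) * Ωp' ^ (2 * n))) ∧
        (‖((PowerSeries.coeff m Q : 𝓞_ℂ_[p]) : ℂ_[p])‖ = 1 ∧
          ∀ i < m, ‖((PowerSeries.coeff i Q : 𝓞_ℂ_[p]) : ℂ_[p])‖ < 1)) →
      ∃ (ΩK'' : ℂ) (Ωp'' : (unrIntegers p)ˣ) (Lφ : UnrSeries p), ΩK'' ≠ 0 ∧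
        IsKatzLFunction ι' v vbar (∅ : Finset (HeightOneSpectrum (𝓞 K))) κ γ θK ΩK''
          ((Ωp'' : unrIntegers p) : ℂ_[p]) Lφ ∧
        FirstUnitCoeffAt Lφ m := by
  intro hp hgood hred hanom hGL K _ _ hK hHN hHp hodd h3 ι v vbar hιv hvbar hne κ hκ γ hγ ι' hι' Φ hΦ
    θsub θquot _ hquot θK hθK m hflat
  haveI : IsCMField K := hK.isCMField
  have hp2 : p ≠ 2 := by omega
  -- the `R₀`-frame exists (CGLS Thm. 2.1.2 by name)
  have hex := exists_isKatzLFunction_of_teichmullerPair h212 W p hp hgood hred hanom hGL hK hHN hHp hodd h3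
    hιv hvbar hne hκ γ ι' hι' hΦ hquot hθK
  -- `θ_K` has finite order
  obtain ⟨hfin, -, -⟩ := heckeCharOf_quotChar_finiteOrder_galConj_unramified W p hp hgood hred hanom
    hGL ι' hΦ hquot hθK
  -- the index passes from the ♭-frame to every `R₀`-frame (w4 gen 2)
  exact exists_isKatzLFunction_firstUnitCoeffAt_of_katzFlat hp2 hK hκ hγ.out hfin hex hflat

/-! ## §2 AN-F₂ in the `K`-currency (the idea file's `KatzLineDescentAt W p`, token for token) -/

/-- **AN-F₂ `KatzLineDescentAt W p` (idea-11 g5 rev 2, `K`-currency, binders token for token,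
`IsKatzLFunctionInt` / `IntFirstUnitCoeffAt` unfolded), from CGLS Thm. 2.1.2 by name**: every residual
pair `(θsub, θquot)` of `E[p](K̄)` over `K` is the restricted Teichmüller pair of a rational `p`-line
(`ResidualLineRigidity.residualPair_eq_restrictField`), so §2 applies.
[cite: CastellaGrossiLeeSkinner2022, Thm. 2.1.2 (arXiv:2008.02571v2 TeX L1015–1041)]
[cite: KellerYin2024, §1.4 and Thms. 2.2.1–2.2.2 (arXiv:2402.12781v2 TeX L1063–1086, L1426–1448)] -/
theorem katzLineDescent_of_thm212 (h212 : thm212_exists_isKatzLFunction)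
    (W : WeierstrassCurve ℚ) [W.IsElliptic] [W.IsGloballyMinimal] (p : ℕ) [Fact p.Prime] :
    2 < p → Good W p → Red W p → Anom W p →
    (∀ Φ : AddSubgroup (geomTorsion W (p : ℤ)), IsRationalLine W p Φ → ¬ LineUnramifiedAt W p Φ) →
    ∀ (K : Type) [Field K] [NumberField K], IsImaginaryQuadratic K →
      SatisfiesHeegnerHypothesis (W.conductorNorm ℤ) K → SatisfiesHeegnerHypothesis p K →
      Odd (NumberField.discr K) → NumberField.discr K ≠ -3 →
    ∀ (ι : K →+* ℚ_[p]) (v vbar : HeightOneSpectrum (𝓞 K)),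
      (∀ x : 𝓞 K, x ∈ v.asIdeal ↔ ‖ι (x : K)‖ < 1) →
      ((p : ℕ) : 𝓞 K) ∈ vbar.asIdeal → vbar ≠ v →
    ∀ (κ : ZpExtension K p), κ.IsAnticyclotomic →
    ∀ (γ : absoluteGaloisGroup K) [Fact (κ.IsTopGenerator γ)],
    ∀ (ι' : PadicAlgCl p ≃+* ℂ),
      (∀ (w : InfinitePlace K) (k : 𝓞 K), k ∈ v.asIdeal ↔ ‖ι'.symm (w.embedding (k : K))‖ < 1) →
    ∀ (θsub θquot : FramedGaloisRep K (padicCoeffIntegers (∅ : Set (PadicAlgCl p))) 1),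
      IsResidualPairOver (W.baseChange K) p θsub θquot →
    ∀ (θK : HeckeCharacter K), IsHeckeCharOf ι' θquot θK →
    ∀ m : ℕ,
      (∃ (ΩK' : ℂ) (Ωp' : ℂ_[p]) (Q : PowerSeries 𝓞_ℂ_[p]), ΩK' ≠ 0 ∧ ‖Ωp'‖ = 1 ∧
        (∀ (φ : HeckeCharacter K) (n : ℕ), 0 < n → (p - 1) ∣ n →
          (∀ w : HeightOneSpectrum (𝓞 K), φ.IsUnramifiedAt w) →
          φ.HasInfinityType (fun _ ↦ (n : ℤ)) (fun _ ↦ -(n : ℤ)) →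
          ∀ (hL : LFunction.HasEntireContinuation (heckeLFunction (θK * φ))),
          ∀ r : FramedGaloisRep K (PadicAlgCl p) 1, IsPAdicAvatarOf ι' φ r → FactorsThroughZp κ r →
            IntSeries.HasValueAt Q (avatarValueAt r γ - 1)
              (((ι'.symm (katzInterpolationValue p θK v vbar ∅ φ n ΩK' (hL.continuation 1)) :
                  PadicAlgCl p) : ℂ_[p]) * Ωp' ^ (2 * n))) ∧
        (‖((PowerSeries.coeff m Q : 𝓞_ℂ_[p]) : ℂ_[p])‖ = 1 ∧
          ∀ i < m, ‖((PowerSeries.coeff i Q : 𝓞_ℂ_[p]) : ℂ_[p])‖ < 1)) →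
      ∃ (ΩK'' : ℂ) (Ωp'' : (unrIntegers p)ˣ) (Lφ : UnrSeries p), ΩK'' ≠ 0 ∧
        IsKatzLFunction ι' v vbar (∅ : Finset (HeightOneSpectrum (𝓞 K))) κ γ θK ΩK''
          ((Ωp'' : unrIntegers p) : ℂ_[p]) Lφ ∧
        FirstUnitCoeffAt Lφ m := by
  intro hp hgood hred hanom hGL K _ _ hK hHN hHp hodd h3 ι v vbar hιv hvbar hne κ hκ γ hγ ι' hι'
    θsub θquot hpair θK hθK m hflat
  have hp2 : p ≠ 2 := by omega
  obtain ⟨Φ₀, hΦ₀, θsub₀, θquot₀, hsub₀, hquot₀⟩ := exists_teichmullerPair W p hred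
  obtain ⟨-, hq⟩ := residualPair_eq_restrictField W p K hp2 hanom hGL hK hΦ₀ hsub₀ hquot₀ hpair
  subst hq
  exact katzLineDescentQ_of_thm212 h212 W p hp hgood hred hanom hGL K hK hHN hHp hodd h3 ι v vbar hιv
    hvbar hne κ hκ γ ι' hι' Φ₀ hΦ₀ θsub₀ θquot₀ hsub₀ hquot₀ θK hθK m hflat

/-! ## §3 The registered stub `stub_katzLineDescentQ` of skeleton `halves` v19, BY NAME -/

/-- **Stub 3c of `Cruxes/GoodLatticeBDPValue/Lines/halves.lean` v19 (`stub_katzLineDescentQ`), header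
VERBATIM**: AN-F₂ in the `ℚ`-currency behind `thm212_exists_isKatzLFunction →` — closed by §1.
[cite: CastellaGrossiLeeSkinner2022, Thm. 2.1.2 (arXiv:2008.02571v2 TeX L1015–1041)]
[cite: KellerYin2024, Thms. 2.2.1–2.2.2 (arXiv:2402.12781v2 TeX L1426–1448)] [cite: Washington1997, §7.1 Prop. 7.2, §7.2] -/
theorem stub_katzLineDescentQ :
    thm212_exists_isKatzLFunction →
    ∀ (W : WeierstrassCurve ℚ) [W.IsElliptic] [W.IsGloballyMinimal] (p : ℕ) [Fact p.Prime],
      2 < p → Good W p → Red W p → Anom W p →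
      (∀ Φ : AddSubgroup (geomTorsion W (p : ℤ)), IsRationalLine W p Φ → ¬ LineUnramifiedAt W p Φ) →
      ∀ (K : Type) [Field K] [NumberField K], IsImaginaryQuadratic K →
        SatisfiesHeegnerHypothesis (W.conductorNorm ℤ) K → SatisfiesHeegnerHypothesis p K →
        Odd (NumberField.discr K) → NumberField.discr K ≠ -3 →
      ∀ (ι : K →+* ℚ_[p]) (v vbar : HeightOneSpectrum (𝓞 K)),
        (∀ x : 𝓞 K, x ∈ v.asIdeal ↔ ‖ι (x : K)‖ < 1) →
        ((p : ℕ) : 𝓞 K) ∈ vbar.asIdeal → vbar ≠ v →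
      ∀ (κ : ZpExtension K p), κ.IsAnticyclotomic →
      ∀ (γ : absoluteGaloisGroup K) [Fact (κ.IsTopGenerator γ)],
      ∀ (ι' : PadicAlgCl p ≃+* ℂ),
        (∀ (w : InfinitePlace K) (k : 𝓞 K), k ∈ v.asIdeal ↔ ‖ι'.symm (w.embedding (k : K))‖ < 1) →
      ∀ (Φ : AddSubgroup (geomTorsion W (p : ℤ))), IsRationalLine W p Φ →
      ∀ (θsub θquot : FramedGaloisRep ℚ (padicCoeffIntegers (∅ : Set (PadicAlgCl p))) 1),
        IsTeichmullerLiftOn (∅ : Set (PadicAlgCl p)) (Φ.map (geomTorsion W (p : ℤ)).subtype) θsub →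
        IsTeichmullerLiftOnQuot (∅ : Set (PadicAlgCl p)) (Φ.map (geomTorsion W (p : ℤ)).subtype)
          (geomTorsion W (p : ℤ)) θquot →
      ∀ (θK : HeckeCharacter K), IsHeckeCharOf ι' (θquot.restrictField K) θK →
      ∀ m : ℕ,
        (∃ (ΩK' : ℂ) (Ωp' : ℂ_[p]) (Q : PowerSeries 𝓞_ℂ_[p]), ΩK' ≠ 0 ∧ ‖Ωp'‖ = 1 ∧
          (∀ (φ : HeckeCharacter K) (n : ℕ), 0 < n → (p - 1) ∣ n →
            (∀ w : HeightOneSpectrum (𝓞 K), φ.IsUnramifiedAt w) →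
            φ.HasInfinityType (fun _ ↦ (n : ℤ)) (fun _ ↦ -(n : ℤ)) →
            ∀ (hL : LFunction.HasEntireContinuation (heckeLFunction (θK * φ))),
            ∀ r : FramedGaloisRep K (PadicAlgCl p) 1, IsPAdicAvatarOf ι' φ r → FactorsThroughZp κ r →
              IntSeries.HasValueAt Q (avatarValueAt r γ - 1)
                (((ι'.symm (katzInterpolationValue p θK v vbar ∅ φ n ΩK' (hL.continuation 1)) :
                    PadicAlgCl p) : ℂ_[p]) * Ωp' ^ (2 * n))) ∧
          (‖((PowerSeries.coeff m Q : 𝓞_ℂ_[p]) : ℂ_[p])‖ = 1 ∧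
            ∀ i < m, ‖((PowerSeries.coeff i Q : 𝓞_ℂ_[p]) : ℂ_[p])‖ < 1)) →
        ∃ (ΩK'' : ℂ) (Ωp'' : (unrIntegers p)ˣ) (Lφ : UnrSeries p), ΩK'' ≠ 0 ∧
          IsKatzLFunction ι' v vbar (∅ : Finset (HeightOneSpectrum (𝓞 K))) κ γ θK ΩK''
            ((Ωp'' : unrIntegers p) : ℂ_[p]) Lφ ∧
          FirstUnitCoeffAt Lφ m :=
  fun h212 W _ _ p _ ↦ katzLineDescentQ_of_thm212 h212 W p

end Summit.BirchSwinnertonDyer.BirchSwinnertonDyer.Theorems.KatzLineDescent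

end
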